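import Literature.AlgebraicGeometry.Resolution.BlowupAlgebraPresentation
import Literature.AlgebraicGeometry.Resolution.BlowupChartRsop
import HarnessLib

/-!
# Crux `PatchingRelPerfect` (stmt-ResolutionOfSingularities-16161), chain w52 — rung toolkit:
# the Rees chart of a PRINCIPAL ideal is the base ring; quasi-regular PAIRS may be swapped

[OURS · L1 W5.2 · rung tool] Two small pieces of chart bookkeeping needed when a tower step blows
up a centre `(xᵢ, e_j)` containing the strict transform `V(e_j)` of a coordinate hyperplane and the
NEXT step uses a base letter transversal to that centre (the surface step `Π₂` followed by the
tangent-Euclid finish in this seat's depth-four certificate, note `NONGRADED-DEPTH4-MEMBER.md`,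
evidence #59 on the crux item; `…CuspDepthFourSurfaceStep.lean`):

* `chartBase_bijective_of_singleton` — for a non-zero-divisor `g`, the structure map
  `R → (R[(g)t])_{(g t)}` of the (only) Rees chart of `Bl_{(g)} Spec R` is BIJECTIVE (the affine
  blowup algebra `R[(g)/g] ⊆ R[1/g]` is the image of `R`, Stacks 052Q / 0804, and `R → R[1/g]` is
  injective); stated as bijectivity of a ring map, never as `≃+*` with a chart-ring side
  (cf. `ChartStrictTransform.exists_strictTransformHom`);
* `IsQuasiRegular.pair_swap` — `(p, q)` quasi-regular iff `(q, p)` is (Matsumura's definition is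
  symmetric in the family; transport along `MvPolynomial.rename` by the swap of `Fin 2`).

Arbitrary commutative rings; nothing here is a statement of the manuscript under review.

## References

* The Stacks Project, Tags 052Q, 0804. [StacksProject]
* H. Matsumura, *Commutative Ring Theory*, CUP 1986, §16 Definition p. 124. [Matsumura1987]
-/

-- `Summit.<Summit>.<Sub>.Theorems` with `Sub = Summit` (single-conjunct summit, D-0017)
set_option linter.dupNamespace false

noncomputable section

open Literature.AlgebraicGeometry.Resolution
open scoped nonZeroDivisors

namespace Summit.ResolutionOfSingularities.ResolutionOfSingularities.Theorems

universe u v w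

namespace ChartPrincipal

section NoRing

variable {R : Type u}

/-- The range of a one-member family. [folklore] -/
theorem range_vec1 (g : R) : Set.range (![g] : Fin 1 → R) = {g} := by
  rw [Matrix.range_cons, Matrix.range_empty, Set.union_empty]

/-- The swap of `Fin 2` reverses a two-member family. [folklore] -/
theorem vec2_comp_swap (p q : R) : (![p, q] : Fin 2 → R) ∘ (Equiv.swap (0 : Fin 2) 1) = ![q, p] := by
  funext i
  fin_cases i <;> rfl

end NoRing

variable {R : Type u} [CommRing R]

/-- **The affine blowup algebra of a principal ideal at its generator is the image of the base**:
`R[(g)/g] = ⊥ ⊆ R[1/g]` (every generator `x/g`, `x = r g`, is `r · (g/g) = r`).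
[cite: StacksProject, Tag 052Q] -/
theorem blowupAlgebra_span_singleton_le_bot (g : R) :
    blowupAlgebra (Ideal.span (Set.range (![g] : Fin 1 → R))) ((![g] : Fin 1 → R) 0) ≤ ⊥ := by
  have hg0 : (![g] : Fin 1 → R) 0 = g := rfl
  rw [blowupAlgebra]
  refine Algebra.adjoin_le ?_
  rintro y ⟨x, hx, rfl⟩
  rw [range_vec1, Ideal.mem_span_singleton'] at hx
  obtain ⟨r, rfl⟩ := hx
  rw [SetLike.mem_coe, Algebra.mem_bot]
  refine ⟨r, ?_⟩
  rw [map_mul, hg0, mul_assoc, IsLocalization.Away.mul_invSelf, mul_one]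

/-- **The Rees chart of a principal ideal generated by a non-zero-divisor is the base ring**: the
structure map `r ↦ r/1` into `(R[(g)t])_{(g t)}` is bijective. [cite: StacksProject, Tag 0804]
[cite: StacksProject, Tag 052Q] -/
theorem chartBase_bijective_of_singleton (g : R) (hg : g ∈ R⁰) :
    Function.Bijective (chartBase (![g] : Fin 1 → R) 0) := by
  have hg0 : (![g] : Fin 1 → R) 0 = g := rfl
  let τ := blowupAlgebra.toBlowupAlgebra (![g] : Fin 1 → R) 0
  have hτ : Function.Bijective τ := blowupAlgebra.toBlowupAlgebra_bijective (![g] : Fin 1 → R) 0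
  have hτbase : ∀ r : R, τ (chartBase (![g] : Fin 1 → R) 0 r) =
      algebraMap R (blowupAlgebra (Ideal.span (Set.range (![g] : Fin 1 → R))) ((![g] : Fin 1 → R) 0)) r :=
    fun r => blowupAlgebra.toBlowupAlgebra_reesChartBase (![g] : Fin 1 → R) 0 r
  have hle : Submonoid.powers ((![g] : Fin 1 → R) 0) ≤ R⁰ := by
    rintro _ ⟨k, rfl⟩
    rw [hg0]
    exact pow_mem hg k
  constructor
  · -- injective: `R → R[1/g]` is injective for a non-zero-divisor `g`
    intro r s hrs
    have h1 : τ (chartBase (![g] : Fin 1 → R) 0 r) = τ (chartBase (![g] : Fin 1 → R) 0 s) := by rw [hrs]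
    rw [hτbase, hτbase] at h1
    have h2 : algebraMap R (Localization.Away ((![g] : Fin 1 → R) 0)) r =
        algebraMap R (Localization.Away ((![g] : Fin 1 → R) 0)) s := congrArg Subtype.val h1
    exact IsLocalization.injective (Localization.Away ((![g] : Fin 1 → R) 0)) hle h2
  · -- surjective: the blowup algebra is the image of `R`
    intro w
    obtain ⟨r, hr⟩ : ∃ r : R, algebraMap R (Localization.Away ((![g] : Fin 1 → R) 0)) r = (τ w).1 := by
      have hw := blowupAlgebra_span_singleton_le_bot g (τ w).2
      rw [Algebra.mem_bot] at hw
      obtain ⟨r, hr⟩ := hw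
      exact ⟨r, hr⟩
    refine ⟨r, hτ.1 ?_⟩
    rw [hτbase]
    exact Subtype.ext hr

/-! ## Swapping a quasi-regular pair -/

/-- Quasi-regularity is invariant under re-indexing the family along an equivalence.
[cite: Matsumura1987, §16 Definition p. 124] -/
theorem isQuasiRegular_comp_equiv {ι : Type v} {κ : Type w} (e : κ ≃ ι) {x : ι → R} (hx : IsQuasiRegular x) :
    IsQuasiRegular (x ∘ e) := by
  classical
  have hrange : Set.range (x ∘ e) = Set.range x := by
    rw [Set.range_comp, e.surjective.range_eq, Set.image_univ]
  intro n F hF hFx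
  rw [hrange] at hFx ⊢
  have hG : (MvPolynomial.rename e F).IsHomogeneous n := hF.rename_isHomogeneous
  have hGx : MvPolynomial.eval x (MvPolynomial.rename e F) ∈ Ideal.span (Set.range x) ^ (n + 1) := by
    rw [MvPolynomial.eval_rename]
    exact hFx
  have hGm := (isQuasiRegular_def x).mp hx n _ hG hGx
  rw [MvPolynomial.mem_map_C_iff]
  intro m
  have hm := hGm (Finsupp.mapDomain e m)
  rwa [MvPolynomial.coeff_rename_mapDomain e e.injective] at hm

/-- **A quasi-regular pair may be swapped.** [cite: Matsumura1987, §16 Definition p. 124] -/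
theorem isQuasiRegular_pair_swap {p q : R} (h : IsQuasiRegular (![p, q] : Fin 2 → R)) :
    IsQuasiRegular (![q, p] : Fin 2 → R) := by
  rw [← vec2_comp_swap p q]
  exact isQuasiRegular_comp_equiv _ h

end ChartPrincipal

end Summit.ResolutionOfSingularities.ResolutionOfSingularities.Theorems

end
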